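import Summits.QuantumFields.YangMills.Theorems.BalabanUVNodesK0RecordFormatNames
import Literature.MathematicalPhysics.QuantumFieldTheory.Balaban1983to89.Node00.Sect2RegionGeometry

/-!
# K0⁷ — RECORD-SIDE FORMAT NAMES, LEMMAS 17: `recordUc` IS ANTITONE IN THE DOMAIN AT THE RECORD (consumer check C-2 of hand-27930-G3C ∕ ★★★ director-ym №565 (3))

Cell `ym-nodeO-ideate` ∕ `ym-balaban-port`, DEFINER seat `ym-nodeO-def-1` (gen 37); `--kind proof --supports stmt-QuantumFields-20541 --as helper`; count-neutral; THEOREMS ONLY.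
[I] = [Balaban1987RG1].

WHY (hand-27930-G3C g0 RESULT, nodeO STATUS 2026-08-31T11:05:54Z, CONSUMER CHECK C-2; ★★★ director-ym №565 (3); this seat's answer l.5268).  The G-P6 road evaluates
the carrier pieces `TY n Y φ`, `Y ⊆ X`, at a configuration `φ` with `encodeCfg φ ∈ recordUc … X`, while (P4) of ✓`P0CarrierClauses` grants analyticity and the Schur bounds at
`encodeCfg φ ∈ recordUc … Y`.  The frame `Sect2.frameI Rz M j Y` of the space `U^c_j(Y, α₀, α₁)` reads `Y` in FOUR places — the region `X := regionOfSet Y`, the (I.1.12) cubes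
`cubesI M j Y`, the two-layer interior `X₂ := regionOfSet (innerT … 2 Y)`, and the (I.1.15) background functions `bg := Rz.bgI j Y` — and the last is NOT monotone-by-restriction
for a general residual recipe (print's `U_n(M˙(·))` «X as Ω₀»).  AT THE RECORD, however, the residual is the UNIT recipe `RzOfRecord := Sect2.Residual.unit`
(`Node00/Record12Residuals` §3: `bgI := fun _ _ => ⟨fun _ _ => 1, fun _ _ _ => 0⟩` — its junk direction is ENLARGEMENT of the spaces, said there), which IGNORES `(j, Y)`;
everything else restricts.  Hence the inclusion is a LEMMA and no edition of (P4) ∕ (P4-lat) ∕ `G3CAtRecordL` ∕ the P0-ℂ letters is needed for C-2.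

WHAT THIS FILE IS (theorems only; no Bałaban content — set-theoretic bookkeeping over [I] (1.11)–(1.16) as typed):
* §1 GENERIC (`B12RegularSpaces111`): `satisfies_of_frame_le` ∕ `space_mono_of_frame_le` — if frame `F'` is dominated by frame `F` (its region, its two-layer interior and
  each of its cubes sit componentwise inside the corresponding objects of `F`, and its background functions are THE SAME), then every pair satisfying (i)–(iv) for `F`
  satisfies them for `F'`, and `space 𝓜 F c α₀ α₁ γ₀ ⊆ space 𝓜 F' c α₀ α₁ γ₀` (conditions are pointwise «on X», «on □», «on X̃⁻²»; the local gauge of (1.12) on a bigger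
  cube serves the smaller).
* §2 OF RECORD (`Node00.Sect2`; `regionOfSet_*_mono` ∕ `innerT_mono` REUSED from ✓`Node00/Sect2RegionGeometry`): `cubesI_transfer` (cubes transfer), `domSites_subset_of_subset`;
  ★ `recordUc_antitone : Y.1 ⊆ X.1 → recordUc F Mc k α₀ α₁ K X ⊆ recordUc F Mc k α₀ α₁ K Y`.
CAVEAT (HONEST, recorded for a future analytic residual): the antitonicity is a property of the UNIT `bgI`; an analytic (I.1.15) recipe would have to be typed
MONOTONE-BY-RESTRICTION (same background functions for `Y ⊆ X` on `Y`'s interior) or C-2 returns for it.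

HONEST FRAMING.  Set inclusions; NO estimate of Bałaban's; nothing asserted, ported or discharged; ⟨27930⟩ OPEN (2∕6 by name), `stub_P0C ∕ stub_G3C ∕ stub_LZdetGlue ∕ stub_FE` OPEN;
⟨26900⟩ OPEN; K0ᴬ ∕ K1ᴬ ∕ K3ᴬ OPEN; NODE O not inhabited (0∕1); COUNT 8∕28 · K 1∕4 UNMOVED; finite `𝕋⁴_{L^K}` at fixed ε — NOT continuum ∕ ℝ⁴ ∕ OS; **the Yang–Mills mass
gap (Clay) is NOT proved by any of this.**  No `sorry`; standard axioms.
-/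

noncomputable section

open scoped BigOperators Matrix.Norms.L2Operator
open Set

/-! ## §1  GENERIC: the spaces (1.11)–(1.16) are antitone under frame domination -/

namespace Literature.MathematicalPhysics.QuantumFieldTheory.Balaban1983to89.B12RegularSpaces111

variable {P : Params} {i : ℕ} {𝔸 : Type*} [NormedRing 𝔸] [NormedAlgebra ℂ 𝔸] [CompleteSpace 𝔸]
variable {𝓜 : Model 𝔸}

/-- **(i)–(iv) ARE ANTITONE UNDER FRAME DOMINATION**: if `F'.X ⊑ F.X`, `F'.X₂ ⊑ F.X₂` componentwise, `F'.bg = F.bg`, and every cube of `F'` sits componentwise inside some cube of `F`,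
then a pair satisfying (1.11)–(1.16) for `F` satisfies them for `F'` — with the SAME factorisation `𝐔 = (exp iξA′)U` and, per cube, the SAME local gauge `(u, A)` of (1.12).
[cite: Balaban1987RG1, (1.11)–(1.16) p.262 (bookkeeping: the conditions are pointwise «on X», «on □», «on X̃⁻²»)] -/
theorem satisfies_of_frame_le {F F' : Frame P i 𝔸} {c : StepConsts} {α₀ α₁ γ₀ : ℝ}
    (hXb : F'.X.bonds ⊆ F.X.bonds) (hXp : F'.X.plaqs ⊆ F.X.plaqs) (hXd : F'.X.dpairs ⊆ F.X.dpairs)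
    (h₂b : F'.X₂.bonds ⊆ F.X₂.bonds) (h₂p : F'.X₂.plaqs ⊆ F.X₂.plaqs) (hbg : F'.bg = F.bg)
    (hcubes : ∀ C' ∈ F'.cubes, ∃ C ∈ F.cubes, C'.bonds ⊆ C.bonds ∧ C'.dpairs ⊆ C.dpairs)
    {Φ : FieldPair P i 𝔸ˣ 𝔸} (h : Satisfies 𝓜 F c α₀ α₁ γ₀ Φ) : Satisfies 𝓜 F' c α₀ α₁ γ₀ Φ := by
  obtain ⟨hG, hg, U, A', hf, h1, h2, h3, h4, h4'⟩ := h
  have hIV : ∀ V : PBond P i → 𝔸ˣ, CondIV F.bg F.X₂ c α₀ V → CondIV F'.bg F'.X₂ c α₀ V := fun V hV => by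
    rw [hbg]
    exact ⟨fun n h1n hn p hp => hV.plaq_lt n h1n hn p (h₂p hp), fun n h1n hn b hb => hV.J_lt n h1n hn b (h₂b hb)⟩
  refine ⟨fun b hb => hG b (hXb hb), fun b hb => hg b (hXb hb), U, A', hf, ?_, ?_, ?_, hIV _ h4, hIV _ h4'⟩
  · refine ⟨fun b hb => h1.gValued b (hXb hb), fun p hp => h1.plaq_lt p (hXp hp), fun C' hC' => ?_⟩
    obtain ⟨C, hC, hCb, hCd⟩ := hcubes C' hC'
    obtain ⟨u, hu, A, hA1, hA2, hA3⟩ := h1.localGauge C hC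
    exact ⟨u, hu, A, fun b hb => hA1 b (hCb hb), fun b hb => hA2 b (hCb hb), fun q hq => hA3 q (hCd hq)⟩
  · exact ⟨fun b hb => h2.gcValued b (hXb hb), fun b hb => h2.norm_lt b (hXb hb), fun q hq => h2.nabla_lt q (hXd hq)⟩
  · exact ⟨fun p hp => h3.plaq_lt p (hXp hp), fun b hb => h3.J_lt b (hXb hb)⟩

/-- **`U^c_j` IS ANTITONE UNDER FRAME DOMINATION** (the union of `Gᶜ`-orbits of `satisfies_of_frame_le`). [cite: Balaban1987RG1, (1.11)–(1.16) p.262 (bookkeeping)] -/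
theorem space_mono_of_frame_le {F F' : Frame P i 𝔸} (c : StepConsts) (α₀ α₁ γ₀ : ℝ)
    (hXb : F'.X.bonds ⊆ F.X.bonds) (hXp : F'.X.plaqs ⊆ F.X.plaqs) (hXd : F'.X.dpairs ⊆ F.X.dpairs)
    (h₂b : F'.X₂.bonds ⊆ F.X₂.bonds) (h₂p : F'.X₂.plaqs ⊆ F.X₂.plaqs) (hbg : F'.bg = F.bg)
    (hcubes : ∀ C' ∈ F'.cubes, ∃ C ∈ F.cubes, C'.bonds ⊆ C.bonds ∧ C'.dpairs ⊆ C.dpairs) :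
    space 𝓜 F c α₀ α₁ γ₀ ⊆ space 𝓜 F' c α₀ α₁ γ₀ := by
  rintro Φ ⟨u, Φ₀, hu, h₀, rfl⟩
  exact ⟨u, Φ₀, hu, satisfies_of_frame_le hXb hXp hXd h₂b h₂p hbg hcubes h₀, rfl⟩

end Literature.MathematicalPhysics.QuantumFieldTheory.Balaban1983to89.B12RegularSpaces111

/-! ## §2  OF RECORD: the frame of `recordUc` restricts along `Y ⊆ X` (unit residual recipe), hence `recordUc` is antitone -/

namespace Summit.QuantumFields.YangMills.Theorems.K0RecordFormatNames

open Literature.MathematicalPhysics.QuantumFieldTheory.Balaban1983to89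
open Literature.MathematicalPhysics.QuantumFieldTheory.Balaban1983to89.Node00
open Literature.MathematicalPhysics.QuantumFieldTheory.Balaban1983to89.T4Continuum (T4Family)

section Geometry

variable (P : Params)

/-- Every (I.1.12) cube-region of `S` sits componentwise inside a cube-region of `T ⊇ S` (the same cube, intersected with the bigger set).
[cite: Balaban1987RG1, (1.12) p.262 (bookkeeping «for each cube □ ⊂ X»)] -/
theorem cubesI_transfer (M j : ℕ) {S T : Set (Site P 0)} (h : S ⊆ T) :
    ∀ C' ∈ Sect2.cubesI (P := P) M j S, ∃ C ∈ Sect2.cubesI (P := P) M j T, C'.bonds ⊆ C.bonds ∧ C'.dpairs ⊆ C.dpairs := by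
  rintro C' ⟨a, ha, hne, rfl⟩
  have hsub : cubeEnl P (B14.Eq213MaximalDomains.side P.L M (j + 1)) a 0 ∩ S ⊆ cubeEnl P (B14.Eq213MaximalDomains.side P.L M (j + 1)) a 0 ∩ T := Set.inter_subset_inter_right _ h
  exact ⟨Sect2.regionOfSet P (cubeEnl P (B14.Eq213MaximalDomains.side P.L M (j + 1)) a 0 ∩ T), ⟨a, ha, hne.mono hsub, rfl⟩,
    Sect2.regionOfSet_bonds_mono hsub, Sect2.regionOfSet_dpairs_mono hsub⟩

/-- The site set of a localization domain is monotone in the domain (`Z ⊆ X` as cube families ⇒ `domSites Z ⊆ domSites X`).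
[cite: Balaban1987RG1, p.257 (bookkeeping: «every localization domain X is a union of … cubes»)] -/
theorem domSites_subset_of_subset (M j : ℕ) {Z X : (Sect2.domSys P M j).Dom}
    (h : (Subtype.val Z : Finset (TreeLengthTorus.TPt P.d (Sect2.domCount P M j))) ⊆ Subtype.val X) :
    Sect2.domSites P M j Z ⊆ Sect2.domSites P M j X := by
  intro s hs
  simp only [Sect2.domSites, Set.mem_iUnion] at hs ⊢
  obtain ⟨x, hx, hsx⟩ := hs
  exact ⟨x, h hx, hsx⟩

end Geometry

variable (F : T4Family)

/-- **THE FRAME OF RECORD RESTRICTS**: for site sets `S ⊆ T` and ANY step `(Mc, j)`, the space of the unit-residual frame of `T` lies in that of `S`: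
`space' (suModel 2) (frameI (RzOfRecord F 2 K) Mc j T) c α₀ α₁ ⊆ space' … (frameI (RzOfRecord F 2 K) Mc j S) c α₀ α₁` — the background functions of `RzOfRecord` do not read the
region (`rfl`), the rest is `space_mono_of_frame_le`. [cite: Balaban1987RG1, (1.11)–(1.16) p.262 (bookkeeping)] -/
theorem space'_frameI_record_antitone (K Mc j : ℕ) (c : B12RegularSpaces111.StepConsts) (α₀ α₁ : ℝ) {S T : Set (Site (F.P K) 0)} (h : S ⊆ T) :
    B12RegularSpaces111.space' (B12RegularSpaces111SpecialUnitary.suModel 2) (Sect2.frameI (RzOfRecord F 2 K) Mc j T) c α₀ α₁ ⊆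
      B12RegularSpaces111.space' (B12RegularSpaces111SpecialUnitary.suModel 2) (Sect2.frameI (RzOfRecord F 2 K) Mc j S) c α₀ α₁ :=
  B12RegularSpaces111.space_mono_of_frame_le c α₀ α₁ α₀ (Sect2.regionOfSet_bonds_mono h) (Sect2.regionOfSet_plaqs_mono h)
    (Sect2.regionOfSet_dpairs_mono h) (Sect2.regionOfSet_bonds_mono (Sect2.innerT_mono _ 2 h))
    (Sect2.regionOfSet_plaqs_mono (Sect2.innerT_mono _ 2 h)) rfl (cubesI_transfer (F.P K) Mc j h)

/-- ★ **`recordUc` IS ANTITONE IN THE DOMAIN AT THE RECORD** (consumer check C-2): for localization domains `Y ⊆ X` (as cube families), every configuration in the record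
space of `X` lies in the record space of `Y` — `recordUc F Mc k α₀ α₁ K X ⊆ recordUc F Mc k α₀ α₁ K Y`.  So (P4)'s analyticity and Schur bounds for the piece `TY n Y`, granted at
`encodeCfg φ ∈ recordUc … Y`, are available at every evaluation point `encodeCfg φ ∈ recordUc … X` of the G-P6 road.  Holds because the record's residual §2 data are the UNIT recipe
(background functions region-free); set-theoretic, no estimate. [cite: Balaban1987RG1, (1.11)–(1.16) p.262, p.257 (bookkeeping)] -/
theorem recordUc_antitone {Mc k : ℕ} {α₀ α₁ : ℝ} {K : ℕ} {X Y : (recordDomSys F Mc k K).Dom}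
    (h : (Subtype.val Y : Finset (TreeLengthTorus.TPt (F.P K).d (Sect2.domCount (F.P K) Mc (k + 1)))) ⊆ Subtype.val X) :
    recordUc F Mc k α₀ α₁ K X ⊆ recordUc F Mc k α₀ α₁ K Y :=
  Set.preimage_mono (Set.image_mono
    (space'_frameI_record_antitone F K Mc (k + 1) _ α₀ α₁ (domSites_subset_of_subset (F.P K) Mc (k + 1) h)))

end Summit.QuantumFields.YangMills.Theorems.K0RecordFormatNames

end
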